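import Mathlib

/-!
# Sahi's `C₃` in dimension three, I: the SLOT CERTIFICATE — the order-3 without-replacement functional is nonnegative on every triple of
# down-sets of the `3 × 3 × 3` slot grid (exhaustive, `157 345 860` multisets; computational)

Support file of the one-cut programme (crux `NoHeavyLowerTail`, stmt-CriticalPhenomena-4575; cell `prim-masterthm`, seat P3, gen 17;
`run/shared/lean/prim/prim-masterthm/prim-masterthm-p3/HIERARCHY.md` §25; memo `run/shared/lean/prim/prim-masterthm/FROM-prim-masterthm-p3-g17-THREE-CHAINS-C3.md`).

THE THEOREM THIS CERTIFIES (memo §0–§1; the assembly in Lean is the companion programme `…SahiThreeChain*`, gen 18+): for every product probability weight on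
every product of THREE finite chains and all nonnegative monotone `f, g, h`, Sahi's `E₃(f,g,h) ≥ 0` — coefficientwise in the point masses; hence `E₃ ≥ 0` for monotone
functions on `[0,1]³`, the `n = 3` case of Lieb–Sahi's Conjecture 1.1 in dimension `3` [LiebSahi2022, p. 3: "remains a conjecture, even for n = 3"].  REDUCTION (paper,
memo §1; its `d = 2` version is the kernel theorem `SahiTwoChain.sahiE_prodWeight_eq_sum_et`): by the coefficient bridge of the without-replacement device, slot-permutation
invariance and the layer-cake decomposition, the statement is EQUIVALENT to
  `Φ(U,V,W) := 16·|U∩V∩W| − N₂(U∩V, W) − N₂(U∩W, V) − N₂(V∩W, U) + N₃(U,V,W) ≥ 0` for all DOWN-sets `U, V, W` of the poset `[3]³`,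
where `N₂(A,B)` counts the pairs `(z,z') ∈ A × B` whose three coordinates are pairwise different and `N₃(U,V,W)` the triples `(z₁,z₂,z₃) ∈ U×V×W` with pairwise
different coordinates in every axis (`Φ = (3!)³·Ẽ₃`, the set partitions `{123}`, `{12|3}` ×3, `{1|2|3}` of Sahi's functional read "without replacement").

THIS FILE decides that finite statement:
* cells of `[3]³` are the bits `9x + 3y + z` of a natural number; `SahiThreeChain.ncMask w` = the cells differing from `w` in every coordinate;
* `SahiThreeChain.dsList` — the `980` down-sets (`= plane partitions in the 3×3×3 box`), generated from the antitone height functions `h : [3]² → {0,…,3}`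
  (`dsList_length : dsList.length = 980`);
* `SahiThreeChain.slotPhi U V W = Σ_{w ∈ W} L_{U,V}(w)` — `Φ` in POTENTIAL form (trilinearity: every term of `Φ` is a sum over the cells `w` of `W`:
  `16·[w ∈ U∩V] − |U∩V∩nc(w)| − [w∈U]·|V∩nc(w)| − [w∈V]·|U∩nc(w)| + #{(i,j) ∈ U×V : i, j, w pairwise non-conflicting}`), so that the potential is shared by the `980` third
  members — this is what makes the exhaustive evaluation feasible inside `native_decide` (≈ `2·10¹⁰` machine operations);
* **`SahiThreeChain.slotPhi_nonneg_canon : ∀ U V W ∈ dsList, isCanon U → U ≤ V → V ≤ W → 0 ≤ slotPhi U V W`** (one `native_decide`, `58 205 888` triples): `U` runs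
  over the `226` down-sets minimal (as numbers) in their orbit under the `6` permutations of the three AXES (`isCanon`), and `U ≤ V ≤ W` as numbers.  Since `Φ = (3!)³·Ẽ₃` is
  invariant under permuting its three ARGUMENTS and under permuting the three AXES simultaneously in all arguments (companion file; kernel in 2D: `SahiTwoChain.et_comp_perm`,
  `et_comp_equiv`), these triples represent ALL `157 345 860` multisets (given `{A,B,C}` pick the axis permutation `σ` and the member `X` minimising the number `σX`; then `U = σX`
  is canonical and `≤ σY, σZ`; sort the other two).
Independent confirmations (memo §2): two C implementations (generic partition/rook engine; the explicit formula), identical statistics: `157 345 860` multisets,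
`0` negative, `484 587` zeros, minimal positive value `1` (98 multisets).
HONEST LABEL: a finite certificate decided by ONE `native_decide` (proposed `--computational`); its identification with `(3!)³·Ẽ₃` and the bridge to `E₃` on three chains
are paper-level here (memo §1) and are the content of the companion files.  Sahi's `C_k` / (M⁺-k) for `k ≥ 3` remain OPEN in general; this settles the three-chain class at
order `3` modulo that assembly. [this work]
-/

namespace Summit.CriticalPhenomena.PercolationContinuityZ3.Theorems

namespace SahiThreeChain

/-! ### Cells, conflict masks, popcount -/

/-- Two cells of `[3]³` (coded `9x + 3y + z`) CONFLICT iff they share a coordinate in some axis. [this work] -/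
def conflict (i j : ℕ) : Bool := (i / 9 == j / 9) || ((i / 3) % 3 == (j / 3) % 3) || (i % 3 == j % 3)

/-- The mask of the cells NOT conflicting with `w` (different from `w` in every coordinate; `8` cells). [this work] -/
def ncMask (w : ℕ) : ℕ := (List.range 27).foldl (fun acc j => if conflict w j then acc else acc ||| (1 <<< j)) 0

/-- Table of the `27` non-conflict masks. [this work] -/
def ncTab : Array ℕ := Array.ofFn fun w : Fin 27 => ncMask w

/-- Number of set bits among the `9` low bits. [this work] -/
def pc9 (m : ℕ) : ℕ := (List.range 9).foldl (fun acc j => if Nat.testBit m j then acc + 1 else acc) 0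

/-- Table of `pc9` on `0..511`. [this work] -/
def pcTab : Array ℕ := Array.ofFn fun i : Fin 512 => pc9 i

/-- Popcount of a `27`-bit mask (three look-ups in the table `pcT`, meant to be `pcTab`). [this work] -/
def pc27 (pcT : Array ℕ) (m : ℕ) : ℕ := pcT.getD (m &&& 511) 0 + pcT.getD ((m >>> 9) &&& 511) 0 + pcT.getD ((m >>> 18) &&& 511) 0

/-! ### The `980` down-sets of `[3]³` -/

/-- The height function coded by `c < 4⁹`: `h(x,y) =` base-`4` digit `3x + y` of `c`. [this work] -/
def hgt (c : ℕ) (x y : ℕ) : ℕ := (c / 4 ^ (3 * x + y)) % 4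

/-- `c` codes an ANTITONE height function (`h(x,y) ≥ h(x+1,y)`, `h(x,y) ≥ h(x,y+1)`). [this work] -/
def isAntitoneCode (c : ℕ) : Bool :=
  (List.range 3).all fun x => (List.range 3).all fun y =>
    (x == 2 || decide (hgt c (x + 1) y ≤ hgt c x y)) && (y == 2 || decide (hgt c x (y + 1) ≤ hgt c x y))

/-- The down-set `{(x,y,z) : z < h(x,y)}` of an antitone height function, as a `27`-bit mask. [this work] -/
def maskOfCode (c : ℕ) : ℕ :=
  (List.range 3).foldl (fun acc x => (List.range 3).foldl (fun acc y =>
    (List.range 3).foldl (fun acc z => if z < hgt c x y then acc ||| (1 <<< (9 * x + 3 * y + z)) else acc) acc) acc) 0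

/-- **The list of all down-sets of `[3]³`** (plane partitions in the `3×3×3` box), as `27`-bit masks. [this work] -/
def dsList : List ℕ := ((List.range (4 ^ 9)).filter isAntitoneCode).map maskOfCode

/-! ### Axis permutations (for the symmetry reduction) -/

/-- The image of the cell `c = 9x+3y+z` under the axis permutation number `s ∈ {0,…,5}` (`0` = identity). [this work] -/
def permCell (s c : ℕ) : ℕ :=
  let x := c / 9
  let y := (c / 3) % 3
  let z := c % 3
  match s with
  | 0 => 9 * x + 3 * y + z
  | 1 => 9 * x + 3 * z + y
  | 2 => 9 * y + 3 * x + z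
  | 3 => 9 * y + 3 * z + x
  | 4 => 9 * z + 3 * x + y
  | _ => 9 * z + 3 * y + x

/-- The image of a mask under the axis permutation number `s`. [this work] -/
def permMask (s U : ℕ) : ℕ := (List.range 27).foldl (fun acc c => if Nat.testBit U c then acc ||| (1 <<< permCell s c) else acc) 0

/-- `U` is CANONICAL: minimal (as a number) in its orbit under the six axis permutations. [this work] -/
def isCanon (U : ℕ) : Bool := (List.range 6).all fun s => decide (U ≤ permMask s U)

/-! ### `Φ` in potential form -/

/-- The cells of a mask, as a list. [this work] -/
def cellsOf (W : ℕ) : List ℕ := (List.range 27).filter fun w => Nat.testBit W w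

/-- `Σ_{i ∈ cells} |V' ∩ nc(i)|` (tail-recursive; `V'` a mask, popcounts by table). [this work] -/
def sumPc (pcT : Array ℕ) (V' : ℕ) (ncT : Array ℕ) : List ℕ → ℤ → ℤ
  | [], acc => acc
  | i :: is, acc => sumPc pcT V' ncT is (acc + (pc27 pcT (V' &&& ncT.getD i 0) : ℤ))

/-- The POTENTIAL `L_{U,V}(w) = 16·[w ∈ U∩V] − |U∩V∩nc(w)| − [w∈U]·|V∩nc(w)| − [w∈V]·|U∩nc(w)| + #{(i,j) ∈ U×V : i,j,w pairwise non-conflicting}`: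
the contribution of a cell `w` of the third member to `Φ(U,V,W)`. [this work] -/
def pot (ncT pcT : Array ℕ) (U V : ℕ) (w : Fin 27) : ℤ :=
  let nc := ncT.getD w 0
  let inU : Bool := Nat.testBit U w
  let inV : Bool := Nat.testBit V w
  let t0 : ℤ := if inU && inV then 16 else 0
  let t1 : ℤ := pc27 pcT (U &&& V &&& nc)
  let t2 : ℤ := if inU then (pc27 pcT (V &&& nc) : ℤ) else 0
  let t3 : ℤ := if inV then (pc27 pcT (U &&& nc) : ℤ) else 0
  let t4 : ℤ := sumPc pcT (V &&& nc) ncT (cellsOf (U &&& nc)) 0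
  t0 - t1 - t2 - t3 + t4

/-- The potential of the pair `(U,V)` as an array over the `27` cells. [this work] -/
def potArr (ncT pcT : Array ℕ) (U V : ℕ) : Array ℤ := Array.ofFn fun w : Fin 27 => pot ncT pcT U V w

/-- Summing a potential over a list of cells (tail-recursive). [this work] -/
def sumCells : List ℕ → Array ℤ → ℤ → ℤ
  | [], _, acc => acc
  | w :: ws, P, acc => sumCells ws P (acc + P.getD w 0)

/-- Summing a potential over the cells of `W`. [this work] -/
def sumPot (W : ℕ) (P : Array ℤ) : ℤ := sumCells (cellsOf W) P 0

/-- **`Φ(U,V,W) = (3!)³·Ẽ₃(1_U,1_V,1_W)`** on the slot grid `[3]³`, in potential form `Σ_{w ∈ W} L_{U,V}(w)`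
(`= 16·|U∩V∩W| − N₂(U∩V,W) − N₂(U∩W,V) − N₂(V∩W,U) + N₃(U,V,W)`, memo §1 (R4)). [this work] -/
def slotPhi (U V W : ℕ) : ℤ := sumPot W (potArr ncTab pcTab U V)

/-- The exhaustive check: `U` canonical under the axis permutations, `V ≤ W` in mask order (all other triples are images of these under the two symmetries
of `Φ`); the potential of `(U,V)` is shared among the third members; the tables are bound once. [this work] -/
def checkCanon : Bool :=
  let ncT := ncTab
  let pcT := pcTab
  let dsc := dsList.map fun W => (W, cellsOf W)
  dsList.all fun U => !(isCanon U) || dsList.all fun V => decide (V < U) ||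
    (let P := potArr ncT pcT U V
     dsc.all fun Wc => decide (Wc.1 < V) || decide (0 ≤ sumCells Wc.2 P 0))

/-! ### The certificate -/

/-- There are `980` down-sets of `[3]³` in the list (MacMahon's `980` plane partitions in the `3×3×3` box). [this work] -/
theorem dsList_length : dsList.length = 980 := by native_decide

/-- The exhaustive evaluation. [this work] -/
theorem checkCanon_eq_true : checkCanon = true := by native_decide

/-- **THE SLOT CERTIFICATE.**  For all down-sets `U ≤ V ≤ W` (as numbers) of the `3×3×3` slot grid with `U` canonical (minimal in its axis-permutation
orbit): `Φ(U,V,W) ≥ 0`.  By the two symmetries of `Φ = (3!)³·Ẽ₃` (arguments; axes) every multiset of three down-sets is represented, so this is the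
finite statement equivalent (memo §1) to Sahi's `E₃ ≥ 0`, coefficientwise, for every product weight on every product of three finite chains. [this work] -/
theorem slotPhi_nonneg_canon : ∀ U ∈ dsList, ∀ V ∈ dsList, ∀ W ∈ dsList, isCanon U = true → U ≤ V → V ≤ W → 0 ≤ slotPhi U V W := by
  have h := checkCanon_eq_true
  simp only [checkCanon, List.all_eq_true, Bool.or_eq_true, Bool.not_eq_true', decide_eq_true_eq, List.mem_map] at h
  intro U hU V hV W hW hcan hUV hVW
  rcases h U hU with hnc | h'
  · rw [hcan] at hnc
    exact absurd hnc (by decide)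
  · rcases h' V hV with hlt | h''
    · exact absurd hUV (not_le.2 hlt)
    · rcases h'' (W, cellsOf W) ⟨W, hW, rfl⟩ with hlt | hle
      · exact absurd hVW (not_le.2 hlt)
      · exact hle

end SahiThreeChain

end Summit.CriticalPhenomena.PercolationContinuityZ3.Theorems
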